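import Literature.NumberTheory.EllipticCurves.PAdicMeasureTransformUnitTwistProofs
import Literature.NumberTheory.EllipticCurves.PAdicMeasureTransformBranches
import Literature.NumberTheory.EllipticCurves.PAdicLFunctionMinusMultGammaTwist
import Literature.NumberTheory.EllipticCurves.PAdicLFunctionMinusMultFunctionalEquationProofs
import HarnessLib

/-!
# The `ω^i ψ_ε`-branches of the one-term minus Mazur–Tate–Teitelbaum measure at `p ∣ N` are the UNIT TWISTS
# `T ↦ ε(1+T) − 1` of the `ω^i`-branches: `L⁻_p(f, α, ω^iψ_ε, T) = L⁻_p(f, α, ω^i, ε(1+T) − 1)` on integral multiples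
# (proofs only; 0 def, 0 fact)

Topic `NumberTheory/EllipticCurves`; namespace `Literature.NumberTheory.EllipticCurves`. THEOREMS ONLY: no definition, no
named fact, no `instance`, no notation, no `sorry`. Specialisation of the measure-generic
`PAdicMeasureTransformUnitTwistProofs` (`tendsto_twistedRiemannSum_of_distribution`, `iwasawaToPowerSeries_unitTwist_eq_of_eq`)
to the one-term minus measure `msdMinusMeasureMult f α` (`PAdicLFunctionMinusMult`; MTT §I.10 (10.1) with `ε(p) = 0`) and its
twisted branches `padicLFunctionMinusBranchMultTwist f α i ε` (`PAdicLFunctionMinusMultGammaTwist`, DEFINITIONS only there —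
«as a function of `T` this is `T ↦ L⁻(ε(1+T) − 1)`, a substitution that is NOT a formal one, whence a definition of its
own»); the `ω^i`-weights `ζ^i` are absorbed by the tree's push-down `branchTwist i μ` (`PAdicMeasureTransformBranches`,
`weightedRiemannSum_eq`), exactly as for the untwisted branches.

* §3b (measure-generic complements to the sibling's §3) `iwasawaToPowerSeries_unitTwist_eq_of_eq_mul` — PRODUCT form
  `b^ℚ = C t · P^ℚ · L_μ ⟹ (Tw_ε b)^ℚ = C t · (Tw_ε P)^ℚ · L_μ^ψ` (`b, P ∈ Λ`, `t ∈ ℚ_p`: `L_μ ∈ Λ ⊗ ℚ_p`, so after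
  clearing denominators the hypothesis is an identity IN `Λ` to which the ring endomorphism `Tw_ε` applies) and the
  INVERSE direction `iwasawaToPowerSeries_unitTwist_eq_of_eq_mul_twisted` (`ε ε' = 1`: multiples of `L_μ^ψ` twist back
  by `Tw_{ε'}` to multiples of `L_μ`);
* `padicLMinusBranchMultTwistRiemannSum_eq_branchTwist` — the twisted weighted Riemann sums of `μ⁻_{f,α}` are the twisted
  plain Riemann sums of `ω^i μ⁻_{f,α}`;
* **`tendsto_padicLMinusBranchMultTwistRiemannSum_of_norm_sub_one_lt`** — they CONVERGE (to
  `padicLMinusBranchMultTwistCoeff f α i ε k`) for `‖ε − 1‖ < 1`, granted the distribution law and a bound of `μ⁻_{f,α}`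
  (the sibling `PAdicLFunctionMinusMultTwistFunctionalEquationProofs`, seat t42, proves convergence under the finite-order
  hypothesis `ε^{p^j} = 1`, `‖ε‖ ≤ 1` by the weight-twist road; both cover `p = 2`, `ε = −1`);
  `padicLMinusBranchMultTwistCoeff_eq_tsum` (`[T^k]L⁻(ω^iψ_ε) = ∑'_j C(j,k)(ε−1)^{j−k}ε^k·[T^j]L⁻(ω^i)`),
  `norm_padicLMinusBranchMultTwistCoeff_le_of_norm_sub_one_lt` (`≤ C`);
* **`iwasawaToPowerSeries_unitTwist_eq_mul_padicLFunctionMinusBranchMultTwist`** — `Q^ℚ = C c · L⁻_p(f,α,ω^i) ⟹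
  (unitTwist Q ε)^ℚ = C c · L⁻_p(f,α,ω^iψ_ε)` for `Q ∈ Λ`, `ε ∈ 1 + pℤ_p`; newform form `…_of_newform` (`f` rational
  newform, `p ∣ N`, `a_p = ±1`: the hypotheses are the tree's `sum_fiber_msdMinusMeasureMult_succ_eq_of_coeffField` and
  `exists_norm_msdMinusMeasureMult_le`); product forms `iwasawaToPowerSeries_unitTwist_eq_of_eq_mul_padicLFunctionMinusBranchMult`
  (`b^ℚ = C t·P^ℚ·L⁻(ω^i) ⟹ (Tw_ε b)^ℚ = C t·(Tw_ε P)^ℚ·L⁻(ω^iψ_ε)`), `…_eq_of_eq_mul_padicLFunctionMinusBranchMultTwist`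
  (back, `ε ε' = 1`) and their newform form `…_of_newform` (both directions).

Motivation (cell `bsd-2adic`, seat `k4-w3` GEN 2, crux stmt-BirchSwinnertonDyer-22618 C4″, reading R15 of
`Summits/…/ByReductionTypeAtTwoAdditiveReducibleSplitTwistKatoMemberDefs.lean` §4): at `p = 2`, `ε = −1` (`ψ = χ₂`, the
character of `ℚ(√2) = ℚ₁ ⊂ ℚ_∞`) the branch `padicLFunctionMinusBranchMultTwist f 1 1 (−1)` carrying the cyclotomic
Iwasawa theory of an additive `E = E'' ⊗ χ_{−2}` (`E''` split multiplicative at `2`) is the image of the `(−1)`-block branch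
`padicLFunctionMinusBranchMult f 1 1` under the `Λ`-automorphism `Tw : (1+T) ↦ −(1+T)`, so ideal-theoretic statements on
integral multiples (exceptional primes, spans, characteristic ideals) transport between the two blocks. NOT here: the
functional equation of the twisted branches (`PAdicMeasureTransformWeightTwist`), anything Selmer-side.

## References
* B. Mazur, J. Tate, J. Teitelbaum, *On `p`-adic analogues of the conjectures of Birch and Swinnerton-Dyer*, Invent. Math.
  84 (1986) 1–48: §I.10 (10.1) (`ε(p) = 0` at `p ∣ N`), §I.13 (branches, twists by characters of `Γ`). [MazurTateTeitelbaum1986Invent]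
* R. Greenberg, *Iwasawa theory for elliptic curves*, LNM 1716 (1999), §1 pp. 67–68. [GreenbergLNM1716]
-/

noncomputable section

open Filter Topology Finset

open scoped MatrixGroups

open Literature.NumberTheory.EllipticCurves.ModularForms

namespace Literature.NumberTheory.EllipticCurves

variable {p : ℕ} [Fact p.Prime]

/-! ### §3b. Product form and inverse direction of the measure-generic transport (complements to
`PAdicMeasureTransformUnitTwistProofs` §3): `b^ℚ = C t · P^ℚ · L_μ ⟹ (Tw_ε b)^ℚ = C t · (Tw_ε P)^ℚ · L_μ^ψ`, and back -/

section Generic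

variable {μ : (n : ℕ) → ZMod (p ^ n) → ℚ_[p]} {RS TRS : ℕ → ℕ → ℚ_[p]} {ε : ℤ_[p]}
  (hRS : ∀ k n : ℕ, RS k n =
      ∑ᶠ η : rootsOfUnity (torsionOrder p) ℤ_[p], ∑ s : ZMod (p ^ n),
        μ (n + cyclotomicExponent p)
            (PadicInt.toZModPow (n + cyclotomicExponent p) ((η : ℤ_[p]ˣ) : ℤ_[p]) *
              (cyclotomicGenerator p : ZMod (p ^ (n + cyclotomicExponent p))) ^ s.val) *
          ((s.val.choose k : ℕ) : ℚ_[p]))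
  (hTRS : ∀ k n : ℕ, TRS k n =
      ∑ᶠ η : rootsOfUnity (torsionOrder p) ℤ_[p], ∑ s : ZMod (p ^ n),
        (ε : ℚ_[p]) ^ s.val *
          μ (n + cyclotomicExponent p)
            (PadicInt.toZModPow (n + cyclotomicExponent p) ((η : ℤ_[p]ˣ) : ℤ_[p]) *
              (cyclotomicGenerator p : ZMod (p ^ (n + cyclotomicExponent p))) ^ s.val) *
          ((s.val.choose k : ℕ) : ℚ_[p]))

include hRS hTRS

omit hRS hTRS in
/-- Clearing a `p`-adic denominator: every `t ∈ ℚ_p` has `p^r t ∈ ℤ_p` for some `r`. [folklore] -/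
private theorem exists_coe_eq_pow_mul (t : ℚ_[p]) : ∃ (r : ℕ) (t₀ : ℤ_[p]), (t₀ : ℚ_[p]) = (p : ℚ_[p]) ^ r * t := by
  have hp1 : (1 : ℝ) < p := by exact_mod_cast (Fact.out : p.Prime).one_lt
  obtain ⟨r, hr⟩ := pow_unbounded_of_one_lt ‖t‖ hp1
  have hpos : (0 : ℝ) < (p : ℝ) ^ r := by positivity
  have hle : ‖(p : ℚ_[p]) ^ r * t‖ ≤ 1 :=
    calc ‖(p : ℚ_[p]) ^ r * t‖ = ((p : ℝ) ^ r)⁻¹ * ‖t‖ := by rw [norm_mul, norm_pow, Padic.norm_p, inv_pow]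
      _ ≤ ((p : ℝ) ^ r)⁻¹ * (p : ℝ) ^ r := mul_le_mul_of_nonneg_left hr.le (inv_nonneg.mpr hpos.le)
      _ = 1 := inv_mul_cancel₀ hpos.ne'
  exact ⟨r, ⟨_, hle⟩, rfl⟩

omit hRS hTRS in
/-- `unitTwist` is `ℤ_p`-linear for constants: `Tw(C a · b) = C a · Tw b`. [cite: deShalit1987, II.4.17 (52) (p. 77)] -/
private theorem unitTwist_C_mul (hε : ‖ε - 1‖ < 1) (a : ℤ_[p]) (b : IwasawaAlgebra p) :
    PadicIntSeries.unitTwist (PowerSeries.C a * b) ε = PowerSeries.C a * PadicIntSeries.unitTwist b ε := by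
  rw [PadicIntSeries.unitTwist_mul _ _ hε, PadicIntSeries.unitTwist_C a hε]

omit hRS hTRS in
/-- `(C a)^ℚ = C a`. [folklore] -/
private theorem iwasawaToPowerSeries_C (a : ℤ_[p]) :
    iwasawaToPowerSeries p (PowerSeries.C a) = PowerSeries.C (a : ℚ_[p]) := by
  rw [PowerSeries.map_C]
  rfl

omit hRS hTRS in
/-- The algebraic core of the transport: from `p^m L = G^ℚ`, `(Tw G)^ℚ = p^m L'`, `t₀ = p^r t ∈ ℤ_p` and
`b^ℚ = C t · P^ℚ · L` conclude `(Tw b)^ℚ = C t · (Tw P)^ℚ · L'` — the hypothesis becomes the identity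
`p^{m+r} b = t₀ P G` IN `Λ`, `Tw` is a ring endomorphism fixing constants, and `p^{m+r}` cancels in `ℚ_p⟦T⟧`.
[cite: MazurTateTeitelbaum1986Invent, §I.12] -/
private theorem transport_core (hε : ‖ε - 1‖ < 1) {b P G : IwasawaAlgebra p} {t : ℚ_[p]} {m r : ℕ} {t₀ : ℤ_[p]}
    (ht₀ : (t₀ : ℚ_[p]) = (p : ℚ_[p]) ^ r * t) {L L' : PowerSeries ℚ_[p]}
    (hG : PowerSeries.C ((p : ℚ_[p]) ^ m) * L = iwasawaToPowerSeries p G)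
    (hTwG : iwasawaToPowerSeries p (PadicIntSeries.unitTwist G ε) = PowerSeries.C ((p : ℚ_[p]) ^ m) * L')
    (hb : iwasawaToPowerSeries p b = PowerSeries.C t * (iwasawaToPowerSeries p P * L)) :
    iwasawaToPowerSeries p (PadicIntSeries.unitTwist b ε) =
      PowerSeries.C t * (iwasawaToPowerSeries p (PadicIntSeries.unitTwist P ε) * L') := by
  have hp0 : (PowerSeries.C (p : ℚ_[p]) : PowerSeries ℚ_[p]) ≠ 0 := fun h ↦
    (Nat.cast_ne_zero.mpr (Fact.out : p.Prime).ne_zero : (p : ℚ_[p]) ≠ 0)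
      (PowerSeries.C_injective (h.trans (map_zero _).symm))
  -- the hypothesis as an identity in `Λ`
  have hint : PowerSeries.C ((p : ℤ_[p]) ^ (m + r)) * b = PowerSeries.C t₀ * (P * G) := by
    apply iwasawaToPowerSeries_injective p
    simp only [map_mul, map_pow, iwasawaToPowerSeries_C, PadicInt.coe_natCast, ht₀]
    rw [hb, ← hG]
    simp only [map_pow]
    ring
  -- apply `Tw` and read in `ℚ_p⟦T⟧`
  have hTw : iwasawaToPowerSeries p (PadicIntSeries.unitTwist (PowerSeries.C ((p : ℤ_[p]) ^ (m + r)) * b) ε) =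
      iwasawaToPowerSeries p (PadicIntSeries.unitTwist (PowerSeries.C t₀ * (P * G)) ε) := by rw [hint]
  rw [unitTwist_C_mul hε, unitTwist_C_mul hε, PadicIntSeries.unitTwist_mul _ _ hε] at hTw
  simp only [map_mul, map_pow, iwasawaToPowerSeries_C, PadicInt.coe_natCast, ht₀, hTwG] at hTw
  -- cancel `C p ^ (m + r)`
  refine mul_left_cancel₀ (pow_ne_zero (m + r) hp0) ?_
  rw [hTw]
  ring

/-- **Product form of the transport**: if `b^ℚ = C t · P^ℚ · L_μ` (`b, P ∈ Λ`, `t ∈ ℚ_p`; e.g. `P` an exceptional-prime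
polynomial multiplying the transform) then `(Tw_ε b)^ℚ = C t · (Tw_ε P)^ℚ · L_μ^ψ`. Proof: `L_μ ∈ Λ ⊗ ℚ_p`
(`memIwasawaRat_of_forall_norm_coeff_le`: `p^m L_μ = G^ℚ`), so after clearing the denominator of `t` the hypothesis is an
identity IN `Λ` (`iwasawaToPowerSeries_injective`), to which the ring endomorphism `Tw_ε` applies; `(Tw_ε G)^ℚ = p^m L_μ^ψ`
by `iwasawaToPowerSeries_unitTwist_eq_of_eq`. [cite: MazurTateTeitelbaum1986Invent, §I.12–I.13] [cite: GreenbergLNM1716, §1 (pp. 67–68)] -/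
theorem iwasawaToPowerSeries_unitTwist_eq_of_eq_mul
    (hdist : ∀ (n : ℕ) (a : ZMod (p ^ n)),
      ∑ b ∈ Finset.univ.filter (fun b : ZMod (p ^ (n + 1)) ↦
        ZMod.castHom (pow_dvd_pow p n.le_succ) (ZMod (p ^ n)) b = a), μ (n + 1) b = μ n a)
    {C : ℝ} (hC : ∀ (n : ℕ) (a : ZMod (p ^ n)), ‖μ n a‖ ≤ C) (hε : ‖ε - 1‖ < 1)
    {b P : IwasawaAlgebra p} {t : ℚ_[p]}
    (hb : iwasawaToPowerSeries p b = PowerSeries.C t *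
      (iwasawaToPowerSeries p P * PowerSeries.mk fun j ↦ limUnder atTop fun n ↦ RS j n)) :
    iwasawaToPowerSeries p (PadicIntSeries.unitTwist b ε) = PowerSeries.C t *
      (iwasawaToPowerSeries p (PadicIntSeries.unitTwist P ε) *
        PowerSeries.mk fun k ↦ limUnder atTop fun n ↦ TRS k n) := by
  have hLb : ∀ k : ℕ, ‖PowerSeries.coeff k (PowerSeries.mk fun j ↦ limUnder atTop fun n ↦ RS j n)‖ ≤ C :=
    fun k ↦ by rw [PowerSeries.coeff_mk]; exact norm_limUnder_riemannSum_le_of_distribution hRS hdist hC k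
  obtain ⟨m, G, hG⟩ := memIwasawaRat_of_forall_norm_coeff_le (p := p) hLb
  obtain ⟨r, t₀, ht₀⟩ := exists_coe_eq_pow_mul (p := p) t
  exact transport_core hε ht₀ hG (iwasawaToPowerSeries_unitTwist_eq_of_eq hRS hTRS hdist hC hε hG.symm) hb

/-- **Inverse direction**: for `ε ε' = 1` (both in `1 + pℤ_p`), if `b^ℚ = C t · P^ℚ · L_μ^ψ` (a multiple of the TWISTED
transform) then `(Tw_{ε'} b)^ℚ = C t · (Tw_{ε'} P)^ℚ · L_μ` — `Tw_{ε'} ∘ Tw_ε = id` (`unitTwist_unitTwist`,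
`unitTwist_one_right`). [cite: MazurTateTeitelbaum1986Invent, §I.12–I.13] [cite: GreenbergLNM1716, §1 (pp. 67–68)] -/
theorem iwasawaToPowerSeries_unitTwist_eq_of_eq_mul_twisted
    (hdist : ∀ (n : ℕ) (a : ZMod (p ^ n)),
      ∑ b ∈ Finset.univ.filter (fun b : ZMod (p ^ (n + 1)) ↦
        ZMod.castHom (pow_dvd_pow p n.le_succ) (ZMod (p ^ n)) b = a), μ (n + 1) b = μ n a)
    {C : ℝ} (hC : ∀ (n : ℕ) (a : ZMod (p ^ n)), ‖μ n a‖ ≤ C) (hε : ‖ε - 1‖ < 1)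
    {ε' : ℤ_[p]} (hε' : ‖ε' - 1‖ < 1) (hinv : ε * ε' = 1)
    {b P : IwasawaAlgebra p} {t : ℚ_[p]}
    (hb : iwasawaToPowerSeries p b = PowerSeries.C t *
      (iwasawaToPowerSeries p P * PowerSeries.mk fun k ↦ limUnder atTop fun n ↦ TRS k n)) :
    iwasawaToPowerSeries p (PadicIntSeries.unitTwist b ε') = PowerSeries.C t *
      (iwasawaToPowerSeries p (PadicIntSeries.unitTwist P ε') *
        PowerSeries.mk fun j ↦ limUnder atTop fun n ↦ RS j n) := by
  have hLb : ∀ k : ℕ, ‖PowerSeries.coeff k (PowerSeries.mk fun j ↦ limUnder atTop fun n ↦ RS j n)‖ ≤ C :=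
    fun k ↦ by rw [PowerSeries.coeff_mk]; exact norm_limUnder_riemannSum_le_of_distribution hRS hdist hC k
  obtain ⟨m, G, hG⟩ := memIwasawaRat_of_forall_norm_coeff_le (p := p) hLb
  have hTwG := iwasawaToPowerSeries_unitTwist_eq_of_eq hRS hTRS hdist hC hε hG.symm
  have hback : PadicIntSeries.unitTwist (PadicIntSeries.unitTwist G ε) ε' = G := by
    rw [PadicIntSeries.unitTwist_unitTwist G hε hε', hinv, PadicIntSeries.unitTwist_one_right]
  obtain ⟨r, t₀, ht₀⟩ := exists_coe_eq_pow_mul (p := p) t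
  exact transport_core hε' ht₀ hTwG.symm (by rw [hback, hG]) hb

end Generic

/-! ### §4. The one-term minus measure at `p ∣ N`: `L⁻_p(f, α, ω^i ψ_ε) = Tw_ε L⁻_p(f, α, ω^i)` on integral multiples -/

section MinusMult

variable {N : ℕ} (f : CuspForm (CongruenceSubgroup.Gamma0 N) 2) (α : ℚ_[p]) (i : ℕ) (ε : ℚ_[p])

/-- The twisted weighted Riemann sums of `μ⁻_{f,α}` are the twisted PLAIN Riemann sums of `ω^i μ⁻_{f,α}`
(`(ω^i μ)(ζγˢ) = μ(ζγˢ)·ζ^i`: `branchTwist_apply_of_distribution`, `teichWeight_classMap`), granted the distribution law.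
Twin of `weightedRiemannSum_eq` with the extra factor `εˢ`. [cite: MazurTateTeitelbaum1986Invent, §I.13] -/
theorem padicLMinusBranchMultTwistRiemannSum_eq_branchTwist
    (hdist : ∀ (n : ℕ) (a : ZMod (p ^ n)),
      ∑ b ∈ Finset.univ.filter (fun b : ZMod (p ^ (n + 1)) ↦
        ZMod.castHom (pow_dvd_pow p n.le_succ) (ZMod (p ^ n)) b = a),
          msdMinusMeasureMult f α (n + 1) b = msdMinusMeasureMult f α n a)
    (k n : ℕ) :
    padicLMinusBranchMultTwistRiemannSum f α i ε k n =
      ∑ᶠ ζ : rootsOfUnity (torsionOrder p) ℤ_[p], ∑ s : ZMod (p ^ n),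
        ε ^ s.val *
          branchTwist i (msdMinusMeasureMult f α) (n + cyclotomicExponent p)
            (PadicInt.toZModPow (n + cyclotomicExponent p) ((ζ : ℤ_[p]ˣ) : ℤ_[p]) *
              (cyclotomicGenerator p : ZMod (p ^ (n + cyclotomicExponent p))) ^ s.val) *
          ((s.val.choose k : ℕ) : ℚ_[p]) := by
  unfold padicLMinusBranchMultTwistRiemannSum
  refine finsum_congr fun ζ ↦ Finset.sum_congr rfl fun s _ ↦ ?_
  rw [branchTwist_apply_of_distribution hdist i (Nat.le_add_left _ n), teichWeight_classMap p i n ζ s]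
  ring

/-- **The Riemann sums of the `ω^i ψ_ε`-branch of the one-term minus measure CONVERGE**, to
`padicLMinusBranchMultTwistCoeff f α i ε k`, for `‖ε − 1‖ < 1`, granted the distribution law and a bound for `μ⁻_{f,α}`
(tree: `sum_fiber_msdMinusMeasureMult_succ_eq_of_coeffField`, `exists_norm_msdMinusMeasureMult_le`) — so the coefficients
of `padicLFunctionMinusBranchMultTwist f α i ε` are genuine limits, not junk values. [cite: MazurTateTeitelbaum1986Invent, §I.13] -/
theorem tendsto_padicLMinusBranchMultTwistRiemannSum_of_norm_sub_one_lt
    (hdist : ∀ (n : ℕ) (a : ZMod (p ^ n)),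
      ∑ b ∈ Finset.univ.filter (fun b : ZMod (p ^ (n + 1)) ↦
        ZMod.castHom (pow_dvd_pow p n.le_succ) (ZMod (p ^ n)) b = a),
          msdMinusMeasureMult f α (n + 1) b = msdMinusMeasureMult f α n a)
    {C : ℝ} (hC : ∀ (n : ℕ) (a : ZMod (p ^ n)), ‖msdMinusMeasureMult f α n a‖ ≤ C) (hε : ‖ε - 1‖ < 1) (k : ℕ) :
    Tendsto (padicLMinusBranchMultTwistRiemannSum f α i ε k) atTop
      (𝓝 (padicLMinusBranchMultTwistCoeff f α i ε k)) := by
  have h := tendsto_twistedRiemannSum_of_distribution (μ := branchTwist i (msdMinusMeasureMult f α))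
    (RS := padicLMinusBranchMultRiemannSum f α i) (TRS := padicLMinusBranchMultTwistRiemannSum f α i ε)
    (fun k n ↦ weightedRiemannSum_eq (RS := padicLMinusBranchMultRiemannSum f α i) (fun _ _ ↦ rfl) hdist k n)
    (fun k n ↦ padicLMinusBranchMultTwistRiemannSum_eq_branchTwist f α i ε hdist k n)
    (branchTwist_distribution hdist i) (norm_branchTwist_le hC i) hε k
  rw [padicLMinusBranchMultTwistCoeff, h.limUnder_eq]
  exact h

/-- **`[T^k] L⁻_p(f, α, ω^i ψ_ε, T) = ∑'_j C(j,k)(ε−1)^{j−k}ε^k · [T^j] L⁻_p(f, α, ω^i, T)`** for `‖ε − 1‖ < 1`: the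
twisted branch is, coefficientwise, the unit twist `T ↦ ε(1+T) − 1` of the untwisted one.
[cite: MazurTateTeitelbaum1986Invent, §I.13] [cite: GreenbergLNM1716, §1 (pp. 67–68)] -/
theorem padicLMinusBranchMultTwistCoeff_eq_tsum
    (hdist : ∀ (n : ℕ) (a : ZMod (p ^ n)),
      ∑ b ∈ Finset.univ.filter (fun b : ZMod (p ^ (n + 1)) ↦
        ZMod.castHom (pow_dvd_pow p n.le_succ) (ZMod (p ^ n)) b = a),
          msdMinusMeasureMult f α (n + 1) b = msdMinusMeasureMult f α n a)
    {C : ℝ} (hC : ∀ (n : ℕ) (a : ZMod (p ^ n)), ‖msdMinusMeasureMult f α n a‖ ≤ C) (hε : ‖ε - 1‖ < 1) (k : ℕ) :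
    padicLMinusBranchMultTwistCoeff f α i ε k =
      ∑' j : ℕ, ((j.choose k : ℚ_[p]) * (ε - 1) ^ (j - k) * ε ^ k) * padicLMinusBranchMultCoeff f α i j := by
  have h := limUnder_twistedRiemannSum_eq_tsum (μ := branchTwist i (msdMinusMeasureMult f α))
    (RS := padicLMinusBranchMultRiemannSum f α i) (TRS := padicLMinusBranchMultTwistRiemannSum f α i ε)
    (fun k n ↦ weightedRiemannSum_eq (RS := padicLMinusBranchMultRiemannSum f α i) (fun _ _ ↦ rfl) hdist k n)
    (fun k n ↦ padicLMinusBranchMultTwistRiemannSum_eq_branchTwist f α i ε hdist k n)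
    (branchTwist_distribution hdist i) (norm_branchTwist_le hC i) hε k
  simpa only [padicLMinusBranchMultTwistCoeff, padicLMinusBranchMultCoeff] using h

/-- **`‖[T^k] L⁻_p(f, α, ω^i ψ_ε, T)‖ ≤ C`** if `μ⁻_{f,α}` is a distribution bounded by `C` and `‖ε − 1‖ < 1` (so the
twisted branch lies in `Λ ⊗ ℚ_p` with the same denominator bound as the untwisted one).
[cite: MazurTateTeitelbaum1986Invent, §I.12–I.13] -/
theorem norm_padicLMinusBranchMultTwistCoeff_le_of_norm_sub_one_lt
    (hdist : ∀ (n : ℕ) (a : ZMod (p ^ n)),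
      ∑ b ∈ Finset.univ.filter (fun b : ZMod (p ^ (n + 1)) ↦
        ZMod.castHom (pow_dvd_pow p n.le_succ) (ZMod (p ^ n)) b = a),
          msdMinusMeasureMult f α (n + 1) b = msdMinusMeasureMult f α n a)
    {C : ℝ} (hC : ∀ (n : ℕ) (a : ZMod (p ^ n)), ‖msdMinusMeasureMult f α n a‖ ≤ C) (hε : ‖ε - 1‖ < 1) (k : ℕ) :
    ‖padicLMinusBranchMultTwistCoeff f α i ε k‖ ≤ C :=
  norm_limUnder_twistedRiemannSum_le (μ := branchTwist i (msdMinusMeasureMult f α))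
    (RS := padicLMinusBranchMultRiemannSum f α i) (TRS := padicLMinusBranchMultTwistRiemannSum f α i ε)
    (fun k n ↦ weightedRiemannSum_eq (RS := padicLMinusBranchMultRiemannSum f α i) (fun _ _ ↦ rfl) hdist k n)
    (fun k n ↦ padicLMinusBranchMultTwistRiemannSum_eq_branchTwist f α i ε hdist k n)
    (branchTwist_distribution hdist i) (norm_branchTwist_le hC i) hε k

/-- **`Q^ℚ = C c · L⁻_p(f, α, ω^i, T) ⟹ (unitTwist Q ε)^ℚ = C c · L⁻_p(f, α, ω^i ψ_ε, T)`** (`ε ∈ 1 + pℤ_p`): every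
integral multiple of the `ω^i`-branch of the one-term minus measure is carried by the `Λ`-automorphism `(1+T) ↦ ε(1+T)`
(`PadicIntSeries.unitTwistEquiv`) to the same multiple of the `ω^i ψ_ε`-branch — the kernel form of «`L⁻_p(f, α, ω^iψ, T)
= L⁻_p(f, α, ω^i, ε(1+T) − 1)`» (module docstring of `PAdicLFunctionMinusMultGammaTwist`).
[cite: MazurTateTeitelbaum1986Invent, §I.13] [cite: GreenbergLNM1716, §1 (pp. 67–68)] -/
theorem iwasawaToPowerSeries_unitTwist_eq_mul_padicLFunctionMinusBranchMultTwist
    (hdist : ∀ (n : ℕ) (a : ZMod (p ^ n)),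
      ∑ b ∈ Finset.univ.filter (fun b : ZMod (p ^ (n + 1)) ↦
        ZMod.castHom (pow_dvd_pow p n.le_succ) (ZMod (p ^ n)) b = a),
          msdMinusMeasureMult f α (n + 1) b = msdMinusMeasureMult f α n a)
    {C : ℝ} (hC : ∀ (n : ℕ) (a : ZMod (p ^ n)), ‖msdMinusMeasureMult f α n a‖ ≤ C)
    {ε : ℤ_[p]} (hε : ‖ε - 1‖ < 1) {Q : IwasawaAlgebra p} {c : ℚ_[p]}
    (hQ : iwasawaToPowerSeries p Q = PowerSeries.C c * padicLFunctionMinusBranchMult f α i) :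
    iwasawaToPowerSeries p (PadicIntSeries.unitTwist Q ε) =
      PowerSeries.C c * padicLFunctionMinusBranchMultTwist f α i (ε : ℚ_[p]) := by
  exact iwasawaToPowerSeries_unitTwist_eq_of_eq (μ := branchTwist i (msdMinusMeasureMult f α))
    (RS := padicLMinusBranchMultRiemannSum f α i) (TRS := padicLMinusBranchMultTwistRiemannSum f α i (ε : ℚ_[p]))
    (fun k n ↦ weightedRiemannSum_eq (RS := padicLMinusBranchMultRiemannSum f α i) (fun _ _ ↦ rfl) hdist k n)
    (fun k n ↦ padicLMinusBranchMultTwistRiemannSum_eq_branchTwist f α i (ε : ℚ_[p]) hdist k n)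
    (branchTwist_distribution hdist i) (norm_branchTwist_le hC i) hε (Q := Q) (c := c) hQ

/-- **Newform form**: for a rational newform `f` of level `N`, `p ∣ N`, `a_p(f) = a_p ∈ {±1}` (multiplicative reduction,
`α = a_p`) and `ε ∈ 1 + pℤ_p`, every `Q ∈ Λ` with `Q^ℚ = C c · L⁻_p(f, a_p, ω^i, T)` has
`(unitTwist Q ε)^ℚ = C c · L⁻_p(f, a_p, ω^i ψ_ε, T)`; the measure hypotheses are the tree's distribution law
(`sum_fiber_msdMinusMeasureMult_succ_eq_of_coeffField`) and Manin–Drinfeld bound (`exists_norm_msdMinusMeasureMult_le`).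
At `p = 2`, `ε = −1` this is the transport between the `(−1)`- and `(−2)`-split-twist blocks of an additive `2`.
[cite: MazurTateTeitelbaum1986Invent, §I.10 (10.1), §I.13] [cite: GreenbergLNM1716, §1 (pp. 67–68)] -/
theorem iwasawaToPowerSeries_unitTwist_eq_mul_padicLFunctionMinusBranchMultTwist_of_newform [NeZero N]
    (hf : IsNewform0 f) (hQf : coeffField f = ⊥) (hpN : p ∣ N)
    {ap : ℤ} (hap : cuspCoeff f p = ap) (hap1 : ap ^ 2 = 1)
    {ε : ℤ_[p]} (hε : ‖ε - 1‖ < 1) {Q : IwasawaAlgebra p} {c : ℚ_[p]}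
    (hQ : iwasawaToPowerSeries p Q = PowerSeries.C c * padicLFunctionMinusBranchMult f (ap : ℚ_[p]) i) :
    iwasawaToPowerSeries p (PadicIntSeries.unitTwist Q ε) =
      PowerSeries.C c * padicLFunctionMinusBranchMultTwist f (ap : ℚ_[p]) i (ε : ℚ_[p]) := by
  have hap' : ap = 1 ∨ ap = -1 := mul_self_eq_one_iff.mp (by rw [← sq]; exact hap1)
  have hapn : ‖((ap : ℤ) : ℚ_[p])‖ = 1 := by
    rcases hap' with rfl | rfl
    · simp
    · simp
  have hap0 : ((ap : ℤ) : ℚ_[p]) ≠ 0 := fun h0 ↦ by rw [h0, norm_zero] at hapn; exact zero_ne_one hapn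
  have hdist := sum_fiber_msdMinusMeasureMult_succ_eq_of_coeffField (p := p) hf hQf hpN hap hap0
  obtain ⟨C₀, hC₀⟩ := exists_norm_msdMinusMeasureMult_le (f := f) hapn
  exact iwasawaToPowerSeries_unitTwist_eq_mul_padicLFunctionMinusBranchMultTwist f (ap : ℚ_[p]) i hdist hC₀ hε hQ

/-- **Product form for the one-term minus measure**: `b^ℚ = C t · P^ℚ · L⁻_p(f, α, ω^i) ⟹ (Tw_ε b)^ℚ =
C t · (Tw_ε P)^ℚ · L⁻_p(f, α, ω^i ψ_ε)` (`b, P ∈ Λ`, `t ∈ ℚ_p`, `ε ∈ 1 + pℤ_p`) — the shape in which exceptional-prime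
multiples `π · L⁻` are carried (`Tw_ε π` is again a polynomial of degree `1`).
[cite: MazurTateTeitelbaum1986Invent, §I.12–I.13] [cite: GreenbergLNM1716, §1 (pp. 67–68)] -/
theorem iwasawaToPowerSeries_unitTwist_eq_of_eq_mul_padicLFunctionMinusBranchMult
    (hdist : ∀ (n : ℕ) (a : ZMod (p ^ n)),
      ∑ b ∈ Finset.univ.filter (fun b : ZMod (p ^ (n + 1)) ↦
        ZMod.castHom (pow_dvd_pow p n.le_succ) (ZMod (p ^ n)) b = a),
          msdMinusMeasureMult f α (n + 1) b = msdMinusMeasureMult f α n a)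
    {C : ℝ} (hC : ∀ (n : ℕ) (a : ZMod (p ^ n)), ‖msdMinusMeasureMult f α n a‖ ≤ C)
    {ε : ℤ_[p]} (hε : ‖ε - 1‖ < 1) {b P : IwasawaAlgebra p} {t : ℚ_[p]}
    (hb : iwasawaToPowerSeries p b =
      PowerSeries.C t * (iwasawaToPowerSeries p P * padicLFunctionMinusBranchMult f α i)) :
    iwasawaToPowerSeries p (PadicIntSeries.unitTwist b ε) = PowerSeries.C t *
      (iwasawaToPowerSeries p (PadicIntSeries.unitTwist P ε) * padicLFunctionMinusBranchMultTwist f α i (ε : ℚ_[p])) :=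
  iwasawaToPowerSeries_unitTwist_eq_of_eq_mul (μ := branchTwist i (msdMinusMeasureMult f α))
    (RS := padicLMinusBranchMultRiemannSum f α i) (TRS := padicLMinusBranchMultTwistRiemannSum f α i (ε : ℚ_[p]))
    (fun k n ↦ weightedRiemannSum_eq (RS := padicLMinusBranchMultRiemannSum f α i) (fun _ _ ↦ rfl) hdist k n)
    (fun k n ↦ padicLMinusBranchMultTwistRiemannSum_eq_branchTwist f α i (ε : ℚ_[p]) hdist k n)
    (branchTwist_distribution hdist i) (norm_branchTwist_le hC i) hε hb

/-- **Inverse direction for the one-term minus measure**: for `ε ε' = 1`, `b^ℚ = C t · P^ℚ · L⁻_p(f, α, ω^i ψ_ε) ⟹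
(Tw_{ε'} b)^ℚ = C t · (Tw_{ε'} P)^ℚ · L⁻_p(f, α, ω^i)`. At `p = 2`, `ε = ε' = −1`: `Tw` is an involution exchanging the
integral multiples of the `(−1)`-block and `(−2)`-block branches. [cite: MazurTateTeitelbaum1986Invent, §I.12–I.13]
[cite: GreenbergLNM1716, §1 (pp. 67–68)] -/
theorem iwasawaToPowerSeries_unitTwist_eq_of_eq_mul_padicLFunctionMinusBranchMultTwist
    (hdist : ∀ (n : ℕ) (a : ZMod (p ^ n)),
      ∑ b ∈ Finset.univ.filter (fun b : ZMod (p ^ (n + 1)) ↦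
        ZMod.castHom (pow_dvd_pow p n.le_succ) (ZMod (p ^ n)) b = a),
          msdMinusMeasureMult f α (n + 1) b = msdMinusMeasureMult f α n a)
    {C : ℝ} (hC : ∀ (n : ℕ) (a : ZMod (p ^ n)), ‖msdMinusMeasureMult f α n a‖ ≤ C)
    {ε ε' : ℤ_[p]} (hε : ‖ε - 1‖ < 1) (hε' : ‖ε' - 1‖ < 1) (hinv : ε * ε' = 1)
    {b P : IwasawaAlgebra p} {t : ℚ_[p]}
    (hb : iwasawaToPowerSeries p b = PowerSeries.C t *
      (iwasawaToPowerSeries p P * padicLFunctionMinusBranchMultTwist f α i (ε : ℚ_[p]))) :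
    iwasawaToPowerSeries p (PadicIntSeries.unitTwist b ε') = PowerSeries.C t *
      (iwasawaToPowerSeries p (PadicIntSeries.unitTwist P ε') * padicLFunctionMinusBranchMult f α i) :=
  iwasawaToPowerSeries_unitTwist_eq_of_eq_mul_twisted (μ := branchTwist i (msdMinusMeasureMult f α))
    (RS := padicLMinusBranchMultRiemannSum f α i) (TRS := padicLMinusBranchMultTwistRiemannSum f α i (ε : ℚ_[p]))
    (fun k n ↦ weightedRiemannSum_eq (RS := padicLMinusBranchMultRiemannSum f α i) (fun _ _ ↦ rfl) hdist k n)
    (fun k n ↦ padicLMinusBranchMultTwistRiemannSum_eq_branchTwist f α i (ε : ℚ_[p]) hdist k n)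
    (branchTwist_distribution hdist i) (norm_branchTwist_le hC i) hε hε' hinv hb

/-- **Newform form of the product transport, both directions**: `f` a rational newform of level `N`, `p ∣ N`,
`a_p(f) = a_p = ±1`, `ε ε' = 1` principal units. (i) `b^ℚ = C t · P^ℚ · L⁻_p(f, a_p, ω^i) ⟹ (Tw_ε b)^ℚ = C t · (Tw_ε P)^ℚ ·
L⁻_p(f, a_p, ω^iψ_ε)`; (ii) `b^ℚ = C t · P^ℚ · L⁻_p(f, a_p, ω^iψ_ε) ⟹ (Tw_{ε'} b)^ℚ = C t · (Tw_{ε'} P)^ℚ · L⁻_p(f, a_p, ω^i)`.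
[cite: MazurTateTeitelbaum1986Invent, §I.10 (10.1), §I.13] [cite: GreenbergLNM1716, §1 (pp. 67–68)] -/
theorem iwasawaToPowerSeries_unitTwist_eq_of_eq_mul_padicLFunctionMinusBranchMult_of_newform [NeZero N]
    (hf : IsNewform0 f) (hQf : coeffField f = ⊥) (hpN : p ∣ N)
    {ap : ℤ} (hap : cuspCoeff f p = ap) (hap1 : ap ^ 2 = 1)
    {ε ε' : ℤ_[p]} (hε : ‖ε - 1‖ < 1) (hε' : ‖ε' - 1‖ < 1) (hinv : ε * ε' = 1) :
    (∀ {b P : IwasawaAlgebra p} {t : ℚ_[p]},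
      iwasawaToPowerSeries p b =
        PowerSeries.C t * (iwasawaToPowerSeries p P * padicLFunctionMinusBranchMult f (ap : ℚ_[p]) i) →
      iwasawaToPowerSeries p (PadicIntSeries.unitTwist b ε) = PowerSeries.C t *
        (iwasawaToPowerSeries p (PadicIntSeries.unitTwist P ε) *
          padicLFunctionMinusBranchMultTwist f (ap : ℚ_[p]) i (ε : ℚ_[p]))) ∧
    (∀ {b P : IwasawaAlgebra p} {t : ℚ_[p]},
      iwasawaToPowerSeries p b = PowerSeries.C t *
        (iwasawaToPowerSeries p P * padicLFunctionMinusBranchMultTwist f (ap : ℚ_[p]) i (ε : ℚ_[p])) →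
      iwasawaToPowerSeries p (PadicIntSeries.unitTwist b ε') = PowerSeries.C t *
        (iwasawaToPowerSeries p (PadicIntSeries.unitTwist P ε') * padicLFunctionMinusBranchMult f (ap : ℚ_[p]) i)) := by
  have hap' : ap = 1 ∨ ap = -1 := mul_self_eq_one_iff.mp (by rw [← sq]; exact hap1)
  have hapn : ‖((ap : ℤ) : ℚ_[p])‖ = 1 := by
    rcases hap' with rfl | rfl
    · simp
    · simp
  have hap0 : ((ap : ℤ) : ℚ_[p]) ≠ 0 := fun h0 ↦ by rw [h0, norm_zero] at hapn; exact zero_ne_one hapn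
  have hdist := sum_fiber_msdMinusMeasureMult_succ_eq_of_coeffField (p := p) hf hQf hpN hap hap0
  obtain ⟨C₀, hC₀⟩ := exists_norm_msdMinusMeasureMult_le (f := f) hapn
  exact ⟨fun hb ↦ iwasawaToPowerSeries_unitTwist_eq_of_eq_mul_padicLFunctionMinusBranchMult f _ i hdist hC₀ hε hb,
    fun hb ↦ iwasawaToPowerSeries_unitTwist_eq_of_eq_mul_padicLFunctionMinusBranchMultTwist f _ i hdist hC₀
      hε hε' hinv hb⟩

end MinusMult

end Literature.NumberTheory.EllipticCurves

end
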